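import Summits.AtomisticToContinuum.BoseEinsteinCondensation.Theorems.BoxCountShadowSiblingMap
import Summits.AtomisticToContinuum.BoseEinsteinCondensation.Theorems.BECRieszReverseHolderCoarseGrainedReverseHolderStubPartitionComparison
import HarnessLib

/-!
# BoxCountShadowSiblingCoherence — two-scale condensation forces sibling displacement quasi-invariance

THE OBSERVATION (lens-6 g36, DISP dossier).  Block condensation at the PARENT scale `2ℓ` (the horizon piece LOC_h
read at the doubled window, `blockDepletion (K/2) ≤ s`) forces, by Cauchy–Schwarz alone, the block amplitudes of
dyadic SIBLING cells `C, σC` (same parent, indices differing in the lowest binary digit of the first coordinate)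
to be coherent: `∫ Σ_C q_C dY ≤ ∫ Σ_C m_C m_{σC} dY + 2s` (`sum_blockMass_le_siblingAmp_add`).  On each count
fibre `{m_C(Y) = j}` the amplitude product is at most `(t·q_C + q_{σC}/t)/2` for every `t`, so fibres on which
the displacement inequality `Q_{C→σC}(j) ≤ 16·P_C(j)` FAILS cost coherence; summing,
`Σ_C Σ_{j bad} Q_{C→σC}(j) ≤ 8·blockDepletion(K/2)` (`siblingBad_pairMass_le`): the one-coordinate displacement
quasi-invariance of DISP_h, for the sibling neighbour, holds off a set of small PAIR-MASS, for every measurable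
square-integrable amplitude and even `K` — no energy, no symmetry, no positivity.  (The conversion of «small pair
mass» into «small pair weight» is the ring share RSH_h, proved for the designated neighbour `nb`; its sibling
twin is the same proof.)  No instances, no notation, no sorry.
-/

-- (hand-2 g14 landing note: part 2 of 2 — the sibling map / children / geometry of the original file 9 are in
-- `BoxCountShadowSiblingMap`, imported above; Steps 1–2 below are byte-identical to lens-6's text.)


noncomputable section

open MeasureTheory Filter Set
open scoped ENNReal NNReal BigOperators

namespace Summit.AtomisticToContinuum.BoseEinsteinCondensation.Theorems.BoxCountShadow

open Literature.MathematicalPhysics.QuantumManyBody.BoseGas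
open Summit.AtomisticToContinuum.BoseEinsteinCondensation.Theorems.BoxLatticeFSum
open Summit.AtomisticToContinuum.BoseEinsteinCondensation.Theorems.BoxLabelAffinity
open Summit.AtomisticToContinuum.BoseEinsteinCondensation.Theorems.BoxHorizonAffinity

variable {n : ℕ}
/-! ### Step 1: parent-scale condensation forces sibling coherence -/

/-- Pointwise, for one coarse cell: `8 m_P² ≤ 4 Σ_{child} q_C + 4 Σ_{child} m_C m_{σC}`. [folklore] -/
theorem eight_mul_blockAmp_coarse_sq_le {L : ℝ} {K' : ℕ} (hL : 0 < L) (hK' : 0 < K') {Φ : Config (n + 1) → ℝ}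
    (hΦm : Measurable Φ) (P : SubIdx K') (Y : Config n) :
    8 * blockAmp L K' Φ P Y ^ 2 ≤
      4 * ∑ C ∈ children (2 * K') P, blockMass L (2 * K') Φ C Y +
        4 * ∑ C ∈ children (2 * K') P, blockAmp L (2 * K') Φ C Y * blockAmp L (2 * K') Φ (sib C) Y := by
  have hK2 : 0 < 2 * K' := by omega
  have hKe : Even (2 * K') := even_two_mul K'
  set ch := children (2 * K') P with hch
  set m : SubIdx (2 * K') → ℝ≥0∞ := fun C => blockAmp L (2 * K') Φ C Y with hm
  set q : SubIdx (2 * K') → ℝ≥0∞ := fun C => blockMass L (2 * K') Φ C Y with hq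
  have hmq : ∀ C, m C ^ 2 ≤ q C := fun C => blockAmp_sq_le_blockMass hL hK2 hΦm C Y
  set T := ∑ C ∈ ch, m C with hT
  set S := ∑ C ∈ ch, (m C + m (sib C)) with hS
  -- `2T ≤ S`
  have h2T : 2 * T ≤ S := by
    rw [two_mul, hS, Finset.sum_add_distrib]
    exact add_le_add le_rfl (sum_children_le_sum_children_sib hKe P m)
  -- `S² ≤ 8 Σ (m_C + m_{σC})² ≤ 8 (2 Σ q + 2 Σ m m^σ)`
  have hS2 : S ^ 2 ≤ 8 * ∑ C ∈ ch, (m C + m (sib C)) ^ 2 := by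
    refine (Summit.AtomisticToContinuum.BoseEinsteinCondensation.Theorems.CoarseGrainedReverseHolder.PartitionComparison.sq_sum_le_card_mul_sum_sq ch _).trans ?_
    refine mul_le_mul' ?_ le_rfl
    exact_mod_cast card_children_le_eight (K := 2 * K') P
  have hsq : ∀ C, (m C + m (sib C)) ^ 2 ≤ q C + q (sib C) + 2 * (m C * m (sib C)) := by
    intro C
    calc (m C + m (sib C)) ^ 2 = m C ^ 2 + m (sib C) ^ 2 + 2 * (m C * m (sib C)) := by ring
      _ ≤ q C + q (sib C) + 2 * (m C * m (sib C)) := add_le_add (add_le_add (hmq C) (hmq (sib C))) le_rfl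
  have hqs : ∑ C ∈ ch, q (sib C) ≤ ∑ C ∈ ch, q C := by
    have h := sum_children_le_sum_children_sib hKe P (fun C => q (sib C))
    refine h.trans (le_of_eq ?_)
    refine Finset.sum_congr rfl fun C _ => ?_
    simp only [sib_sib hKe]
  have hmain : 4 * T ^ 2 ≤ 16 * (∑ C ∈ ch, q C + ∑ C ∈ ch, m C * m (sib C)) := by
    calc 4 * T ^ 2 = (2 * T) ^ 2 := by ring
      _ ≤ S ^ 2 := by rw [pow_two, pow_two]; exact mul_le_mul' h2T h2T
      _ ≤ 8 * ∑ C ∈ ch, (m C + m (sib C)) ^ 2 := hS2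
      _ ≤ 8 * ∑ C ∈ ch, (q C + q (sib C) + 2 * (m C * m (sib C))) :=
          mul_le_mul' le_rfl (Finset.sum_le_sum fun C _ => hsq C)
      _ = 8 * (∑ C ∈ ch, q C + ∑ C ∈ ch, q (sib C) + 2 * ∑ C ∈ ch, m C * m (sib C)) := by
          rw [Finset.sum_add_distrib, Finset.sum_add_distrib, Finset.mul_sum]
      _ ≤ 8 * (∑ C ∈ ch, q C + ∑ C ∈ ch, q C + 2 * ∑ C ∈ ch, m C * m (sib C)) := by
          gcongr
      _ = 16 * (∑ C ∈ ch, q C + ∑ C ∈ ch, m C * m (sib C)) := by ring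
  -- `8 m_P² = T²`
  have hP : 8 * blockAmp L K' Φ P Y ^ 2 = T ^ 2 := by
    rw [blockAmp_coarse_eq_sum hL hK' Φ P Y, mul_pow, ← mul_assoc, eight_mul_ofReal_inv_sqrt_eight_sq, one_mul]
  rw [hP]
  have h4 : 4 * T ^ 2 ≤ 4 * (4 * ∑ C ∈ ch, q C + 4 * ∑ C ∈ ch, m C * m (sib C)) := by
    calc 4 * T ^ 2 ≤ 16 * (∑ C ∈ ch, q C + ∑ C ∈ ch, m C * m (sib C)) := hmain
      _ = 4 * (4 * ∑ C ∈ ch, q C + 4 * ∑ C ∈ ch, m C * m (sib C)) := by ring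
  exact ennreal_le_of_mul_le_mul_left (by norm_num) ENNReal.ofNat_ne_top h4

/-- **Sibling coherence from parent-scale condensation**: for even block number `2K'`,
`∫ Σ_C q_C dY ≤ ∫ Σ_C m_C m_{σC} dY + 2·blockDepletion(K')`. [folklore] -/
theorem sum_blockMass_le_siblingAmp_add {L : ℝ} {K' : ℕ} (hL : 0 < L) (hK' : 0 < K')
    {Φ : Config (n + 1) → ℝ} (hΦm : Measurable Φ) (hfin : ∫⁻ Y, sliceSq Φ Y ≠ ⊤) :
    ∫⁻ Y, ∑ C : SubIdx (2 * K'), blockMass L (2 * K') Φ C Y ≤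
      (∫⁻ Y, ∑ C : SubIdx (2 * K'), blockAmp L (2 * K') Φ C Y * blockAmp L (2 * K') Φ (sib C) Y) +
        2 * blockDepletion L K' Φ := by
  have hK2 : 0 < 2 * K' := by omega
  set a : Config n → ℝ≥0∞ := fun Y => ∑ C : SubIdx (2 * K'), blockMass L (2 * K') Φ C Y with ha
  set A : Config n → ℝ≥0∞ := fun Y =>
    ∑ C : SubIdx (2 * K'), blockAmp L (2 * K') Φ C Y * blockAmp L (2 * K') Φ (sib C) Y with hA
  set dep : Config n → ℝ≥0∞ := fun Y =>
    ∑ P : SubIdx K', (blockMass L K' Φ P Y - blockAmp L K' Φ P Y ^ 2) with hdep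
  have ham : Measurable a := Finset.measurable_sum _ fun C _ => measurable_blockMass L (2 * K') hΦm C
  have hAm : Measurable A := Finset.measurable_sum _ fun C _ =>
    (measurable_blockAmp L (2 * K') hΦm C).mul (measurable_blockAmp L (2 * K') hΦm (sib C))
  -- pointwise: `8 a ≤ 4 a + 4 A + 8 dep`
  have hpt : ∀ Y, 8 * a Y ≤ 4 * a Y + 4 * A Y + 8 * dep Y := by
    intro Y
    have hcoarse : a Y = ∑ P : SubIdx K', blockMass L K' Φ P Y := by
      simp only [ha, blockMass_coarse_eq_sum hL hK' Φ _ Y]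
      exact sum_eq_sum_children _
    have hA' : A Y = ∑ P : SubIdx K', ∑ C ∈ children (2 * K') P,
        blockAmp L (2 * K') Φ C Y * blockAmp L (2 * K') Φ (sib C) Y := sum_eq_sum_children _
    have ha' : a Y = ∑ P : SubIdx K', ∑ C ∈ children (2 * K') P, blockMass L (2 * K') Φ C Y :=
      sum_eq_sum_children _
    calc 8 * a Y = ∑ P : SubIdx K', 8 * blockMass L K' Φ P Y := by rw [hcoarse, Finset.mul_sum]
      _ ≤ ∑ P : SubIdx K', (8 * blockAmp L K' Φ P Y ^ 2 +
            8 * (blockMass L K' Φ P Y - blockAmp L K' Φ P Y ^ 2)) := by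
          refine Finset.sum_le_sum fun P _ => ?_
          rw [← mul_add]
          exact mul_le_mul' le_rfl le_add_tsub
      _ ≤ ∑ P : SubIdx K', ((4 * ∑ C ∈ children (2 * K') P, blockMass L (2 * K') Φ C Y +
            4 * ∑ C ∈ children (2 * K') P, blockAmp L (2 * K') Φ C Y * blockAmp L (2 * K') Φ (sib C) Y) +
            8 * (blockMass L K' Φ P Y - blockAmp L K' Φ P Y ^ 2)) :=
          Finset.sum_le_sum fun P _ => add_le_add (eight_mul_blockAmp_coarse_sq_le hL hK' hΦm P Y) le_rfl
      _ = 4 * a Y + 4 * A Y + 8 * dep Y := by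
          rw [Finset.sum_add_distrib, Finset.sum_add_distrib, ← Finset.mul_sum, ← Finset.mul_sum,
            ← Finset.mul_sum, ← ha', ← hA']
  -- integrate
  have e1 : ∫⁻ Y, (4 * a Y + 4 * A Y + 8 * dep Y) = (∫⁻ Y, (4 * a Y + 4 * A Y)) + ∫⁻ Y, 8 * dep Y :=
    lintegral_add_left ((ham.const_mul 4).add (hAm.const_mul 4)) _
  have e2 : ∫⁻ Y, (4 * a Y + 4 * A Y) = (∫⁻ Y, 4 * a Y) + ∫⁻ Y, 4 * A Y :=
    lintegral_add_left (ham.const_mul 4) _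
  have e3 : ∫⁻ Y, 4 * a Y = 4 * ∫⁻ Y, a Y := lintegral_const_mul 4 ham
  have e4 : ∫⁻ Y, 4 * A Y = 4 * ∫⁻ Y, A Y := lintegral_const_mul 4 hAm
  have e5 : ∫⁻ Y, 8 * dep Y = 8 * blockDepletion L K' Φ := lintegral_const_mul' _ _ ENNReal.ofNat_ne_top
  have hint : 8 * (∫⁻ Y, a Y) ≤ 4 * (∫⁻ Y, a Y) + 4 * (∫⁻ Y, A Y) + 8 * blockDepletion L K' Φ := by
    calc 8 * (∫⁻ Y, a Y) = ∫⁻ Y, 8 * a Y := (lintegral_const_mul _ ham).symm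
      _ ≤ ∫⁻ Y, (4 * a Y + 4 * A Y + 8 * dep Y) := lintegral_mono hpt
      _ = 4 * (∫⁻ Y, a Y) + 4 * (∫⁻ Y, A Y) + 8 * blockDepletion L K' Φ := by rw [e1, e2, e3, e4, e5]
  -- cancel the finite `4 ∫ a`
  have hafin : (∫⁻ Y, a Y) ≠ ⊤ := by
    refine ne_top_of_le_ne_top hfin (lintegral_mono fun Y => ?_)
    exact sum_blockMass_le_sliceSq hL hK2 hΦm Y
  have h4fin : 4 * (∫⁻ Y, a Y) ≠ ⊤ := ENNReal.mul_ne_top ENNReal.ofNat_ne_top hafin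
  have h8 : 4 * (∫⁻ Y, a Y) + 4 * (∫⁻ Y, a Y) ≤
      4 * (∫⁻ Y, a Y) + (4 * (∫⁻ Y, A Y) + 8 * blockDepletion L K' Φ) := by
    calc 4 * (∫⁻ Y, a Y) + 4 * (∫⁻ Y, a Y) = 8 * (∫⁻ Y, a Y) := by ring
      _ ≤ _ := hint
      _ = _ := add_assoc _ _ _
  have h4 : 4 * (∫⁻ Y, a Y) ≤ 4 * ((∫⁻ Y, A Y) + 2 * blockDepletion L K' Φ) := by
    calc 4 * (∫⁻ Y, a Y) ≤ 4 * (∫⁻ Y, A Y) + 8 * blockDepletion L K' Φ := (ENNReal.add_le_add_iff_left h4fin).1 h8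
      _ = 4 * ((∫⁻ Y, A Y) + 2 * blockDepletion L K' Φ) := by ring
  exact ennreal_le_of_mul_le_mul_left (by norm_num) ENNReal.ofNat_ne_top h4

/-! ### Step 2: fibres where sibling displacement fails cost coherence -/

/-- The pairs `(C, j)` at which SIBLING DISPLACEMENT fails: `16 · P_C(j) < Q_{C→σC}(j)`. [folklore] -/
def sibBad (L : ℝ) (K : ℕ) (Φ : Config (n + 1) → ℝ) : Set (SubIdx K × ℕ) :=
  {p | 16 * cellMass L K Φ p.1 p.2 < cellPairMass L K Φ p.1 (sib p.1) p.2}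

/-- Per cell: `8 ∫ m_C m_{σC} + 2 Σ_{j bad} Q_{C→σC}(j) ≤ 4 (∫ q_C + ∫ q_{σC})`. [folklore] -/
theorem sibling_cell_le {L : ℝ} {K : ℕ} (hL : 0 < L) (hK : 0 < K) {Φ : Config (n + 1) → ℝ}
    (hΦm : Measurable Φ) (C : SubIdx K) :
    8 * (∫⁻ Y, blockAmp L K Φ C Y * blockAmp L K Φ (sib C) Y) +
        2 * ∑' j, (sibBad L K Φ).indicator (fun p => cellPairMass L K Φ p.1 (sib p.1) p.2) (C, j) ≤
      4 * ((∫⁻ Y, blockMass L K Φ C Y) + ∫⁻ Y, blockMass L K Φ (sib C) Y) := by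
  set T : Config n → ℕ := (fun m : SubIdx K → ℕ => m C) ∘ countVec (L / (K : ℝ)) K with hTdef
  have hT : Measurable T := (measurable_pi_apply C).comp (measurable_countVec (L / (K : ℝ)) K)
  set m := blockAmp L K Φ C with hm
  set m' := blockAmp L K Φ (sib C) with hm'
  set q := blockMass L K Φ C with hq
  set q' := blockMass L K Φ (sib C) with hq'
  have hmq : ∀ Y, m Y ^ 2 ≤ q Y := fun Y => blockAmp_sq_le_blockMass hL hK hΦm C Y
  have hmq' : ∀ Y, m' Y ^ 2 ≤ q' Y := fun Y => blockAmp_sq_le_blockMass hL hK hΦm (sib C) Y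
  set I : ℕ → ℝ≥0∞ := fun j => ∫⁻ Y in T ⁻¹' {j}, m Y * m' Y with hI
  set P : ℕ → ℝ≥0∞ := fun j => ∫⁻ Y in T ⁻¹' {j}, q Y with hP
  set Q : ℕ → ℝ≥0∞ := fun j => ∫⁻ Y in T ⁻¹' {j}, q' Y with hQ
  have hPdef : ∀ j, cellMass L K Φ C j = P j := fun j => rfl
  have hQdef : ∀ j, cellPairMass L K Φ C (sib C) j = Q j := fun j => rfl
  -- per fibre
  have hfib : ∀ j, 8 * I j + 2 * (sibBad L K Φ).indicator (fun p => cellPairMass L K Φ p.1 (sib p.1) p.2) (C, j) ≤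
      4 * (P j + Q j) := by
    intro j
    have hgood : 8 * I j ≤ 4 * (P j + Q j) := by
      calc 8 * I j = 4 * ∫⁻ Y in T ⁻¹' {j}, 2 * (m Y * m' Y) := by
            simp only [hI]
            rw [lintegral_const_mul' _ _ ENNReal.ofNat_ne_top, ← mul_assoc]; norm_num
        _ ≤ 4 * ∫⁻ Y in T ⁻¹' {j}, (q Y + q' Y) := by
            refine mul_le_mul' le_rfl (lintegral_mono fun Y => ?_)
            exact (Literature.Probability.LatticeModels.Current.two_mul_mul_le_sq_add_sq _ _).trans (add_le_add (hmq Y) (hmq' Y))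
        _ = 4 * (P j + Q j) := by
            rw [lintegral_add_left ((measurable_blockMass L K hΦm C))]
    by_cases hj : (C, j) ∈ sibBad L K Φ
    · rw [Set.indicator_of_mem hj]
      have hlt : 16 * P j < Q j := hj
      have hbad : 8 * I j ≤ 16 * P j + Q j := by
        calc 8 * I j = ∫⁻ Y in T ⁻¹' {j}, 8 * (m Y * m' Y) := by
              rw [lintegral_const_mul' _ _ ENNReal.ofNat_ne_top]
          _ ≤ ∫⁻ Y in T ⁻¹' {j}, (16 * q Y + q' Y) := by
              refine lintegral_mono fun Y => ?_
              calc 8 * (m Y * m' Y) ≤ 16 * m Y ^ 2 + m' Y ^ 2 := ennreal_eight_mul_mul_le _ _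
                _ ≤ 16 * q Y + q' Y := add_le_add (mul_le_mul' le_rfl (hmq Y)) (hmq' Y)
          _ = 16 * P j + Q j := by
              rw [lintegral_add_left ((measurable_blockMass L K hΦm C).const_mul _),
                lintegral_const_mul' _ _ ENNReal.ofNat_ne_top]
      change 8 * I j + 2 * Q j ≤ 4 * (P j + Q j)
      have h12 : 12 * P j ≤ Q j := (mul_le_mul' (by norm_num) le_rfl : 12 * P j ≤ 16 * P j).trans hlt.le
      calc 8 * I j + 2 * Q j ≤ 16 * P j + Q j + 2 * Q j := add_le_add hbad le_rfl
        _ = 4 * P j + 3 * Q j + 12 * P j := by ring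
        _ ≤ 4 * P j + 3 * Q j + Q j := add_le_add le_rfl h12
        _ = 4 * (P j + Q j) := by ring
    · rw [Set.indicator_of_notMem hj, mul_zero, add_zero]
      exact hgood
  -- sum over the fibres
  have hIsum : ∑' j, I j = ∫⁻ Y, m Y * m' Y := (lintegral_eq_tsum_fibre volume hT _).symm
  have hPsum : ∑' j, P j = ∫⁻ Y, q Y := (lintegral_eq_tsum_fibre volume hT _).symm
  have hQsum : ∑' j, Q j = ∫⁻ Y, q' Y := (lintegral_eq_tsum_fibre volume hT _).symm
  calc 8 * (∫⁻ Y, m Y * m' Y) +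
        2 * ∑' j, (sibBad L K Φ).indicator (fun p => cellPairMass L K Φ p.1 (sib p.1) p.2) (C, j)
      = ∑' j, (8 * I j + 2 * (sibBad L K Φ).indicator (fun p => cellPairMass L K Φ p.1 (sib p.1) p.2) (C, j)) := by
        rw [ENNReal.tsum_add, ENNReal.tsum_mul_left, ENNReal.tsum_mul_left, hIsum]
    _ ≤ ∑' j, 4 * (P j + Q j) := ENNReal.tsum_le_tsum hfib
    _ = 4 * ((∫⁻ Y, q Y) + ∫⁻ Y, q' Y) := by
        rw [ENNReal.tsum_mul_left, ENNReal.tsum_add, hPsum, hQsum]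

/-- **Two-scale condensation ⟹ sibling displacement off a set of small pair mass.**  For every measurable
square-integrable amplitude on `N = n + 1` particles and even block number `2K'`:
`Σ_C Σ_{j : 16 P_C(j) < Q_{C→σC}(j)} Q_{C→σC}(j) ≤ 8 · blockDepletion(K')`. [folklore] -/
theorem siblingBad_pairMass_le {L : ℝ} {K' : ℕ} (hL : 0 < L) (hK' : 0 < K') {Φ : Config (n + 1) → ℝ}
    (hΦm : Measurable Φ) (hfin : ∫⁻ Y, sliceSq Φ Y ≠ ⊤) :
    ∑ C : SubIdx (2 * K'), ∑' j, (sibBad L (2 * K') Φ).indicator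
        (fun p => cellPairMass L (2 * K') Φ p.1 (sib p.1) p.2) (C, j) ≤
      8 * blockDepletion L K' Φ := by
  have hK2 : 0 < 2 * K' := by omega
  have hKe : Even (2 * K') := even_two_mul K'
  set K := 2 * K' with hKdef
  set Bsum := ∑ C : SubIdx K, ∑' j, (sibBad L K Φ).indicator
    (fun p => cellPairMass L K Φ p.1 (sib p.1) p.2) (C, j) with hBsum
  set Aint := ∫⁻ Y, ∑ C : SubIdx K, blockAmp L K Φ C Y * blockAmp L K Φ (sib C) Y with hAint
  set aint := ∫⁻ Y, ∑ C : SubIdx K, blockMass L K Φ C Y with haint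
  have hAeq : Aint = ∑ C : SubIdx K, ∫⁻ Y, blockAmp L K Φ C Y * blockAmp L K Φ (sib C) Y :=
    lintegral_finsetSum _ fun C _ => (measurable_blockAmp L K hΦm C).mul (measurable_blockAmp L K hΦm (sib C))
  have haeq : aint = ∑ C : SubIdx K, ∫⁻ Y, blockMass L K Φ C Y :=
    lintegral_finsetSum _ fun C _ => measurable_blockMass L K hΦm C
  -- Step 2 summed over cells: `8 Aint + 2 Bsum ≤ 8 aint`
  have h1 : 8 * Aint + 2 * Bsum ≤ 8 * aint := by
    calc 8 * Aint + 2 * Bsum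
        = ∑ C : SubIdx K, (8 * (∫⁻ Y, blockAmp L K Φ C Y * blockAmp L K Φ (sib C) Y) +
            2 * ∑' j, (sibBad L K Φ).indicator (fun p => cellPairMass L K Φ p.1 (sib p.1) p.2) (C, j)) := by
          rw [hAeq, hBsum, Finset.mul_sum, Finset.mul_sum, ← Finset.sum_add_distrib]
      _ ≤ ∑ C : SubIdx K, 4 * ((∫⁻ Y, blockMass L K Φ C Y) + ∫⁻ Y, blockMass L K Φ (sib C) Y) :=
          Finset.sum_le_sum fun C _ => sibling_cell_le hL hK2 hΦm C
      _ = 4 * (∑ C : SubIdx K, ∫⁻ Y, blockMass L K Φ C Y) +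
            4 * ∑ C : SubIdx K, ∫⁻ Y, blockMass L K Φ (sib C) Y := by
          rw [← Finset.mul_sum, Finset.sum_add_distrib, mul_add]
      _ = 8 * aint := by
          rw [sum_comp_sib hKe (fun C => ∫⁻ Y, blockMass L K Φ C Y), ← haeq]; ring
  -- Step 1: `aint ≤ Aint + 2 dep`
  have h2 : aint ≤ Aint + 2 * blockDepletion L K' Φ := sum_blockMass_le_siblingAmp_add hL hK' hΦm hfin
  have hafin : aint ≠ ⊤ := by
    refine ne_top_of_le_ne_top hfin (lintegral_mono fun Y => ?_)
    exact sum_blockMass_le_sliceSq hL hK2 hΦm Y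
  have hAfin : Aint ≠ ⊤ := by
    refine ne_top_of_le_ne_top (ENNReal.mul_ne_top ENNReal.ofNat_ne_top hafin) (?_ : Aint ≤ 8 * aint)
    calc Aint ≤ 8 * Aint := by
          conv_lhs => rw [← one_mul Aint]
          exact mul_le_mul' (by norm_num) le_rfl
      _ ≤ 8 * Aint + 2 * Bsum := le_self_add
      _ ≤ 8 * aint := h1
  have h8A : 8 * Aint ≠ ⊤ := ENNReal.mul_ne_top ENNReal.ofNat_ne_top hAfin
  have h3 : 8 * Aint + 2 * Bsum ≤ 8 * Aint + 16 * blockDepletion L K' Φ := by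
    calc 8 * Aint + 2 * Bsum ≤ 8 * aint := h1
      _ ≤ 8 * (Aint + 2 * blockDepletion L K' Φ) := mul_le_mul' le_rfl h2
      _ = 8 * Aint + 16 * blockDepletion L K' Φ := by ring
  have h4 : 2 * Bsum ≤ 2 * (8 * blockDepletion L K' Φ) := by
    calc 2 * Bsum ≤ 16 * blockDepletion L K' Φ := (ENNReal.add_le_add_iff_left h8A).1 h3
      _ = 2 * (8 * blockDepletion L K' Φ) := by ring
  exact ennreal_le_of_mul_le_mul_left two_ne_zero ENNReal.ofNat_ne_top h4

end Summit.AtomisticToContinuum.BoseEinsteinCondensation.Theorems.BoxCountShadow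

end
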